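import Literature.MathematicalPhysics.KineticTheory.HardSphereEulerProofs
import HarnessLib

/-!
# Rung ½ for the crux `EnergyCurrentTails` (stmt-AtomisticToContinuum-9235), stub C:
# the hot-spot divergence `∫ G_V(θhot)² / (∫ G_V(θhot))² → ∞`

Pure Gaussian/measure analysis on `ℝ³` and `𝕋³` (no dynamics).  With `β_b(v) = (1 - ‖v - b‖)₊`,
`G_b(θ) = ∫ β_b dN(0, θ·id)`, `θhot(x) = 2 - ‖x‖ ∈ [3/2, 2]` on `𝕋³` (`‖x‖ ≤ 1/2`) and `b = V e₁` we
prove: `0 < G ≤ 1` (positive continuous Lebesgue density); the reflection symmetry `G_{-b} = G_b`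
(even density, `neg`-invariant Lebesgue measure); continuity of `G_b ∘ θhot` (dominated convergence
after `v = √θ w`); and the divergence, from the DENSITY RATIO
`g_{θ₁} ≤ (θ₂/θ₁)^{3/2} e^{-(V-1)²(θ₁⁻¹-θ₂⁻¹)/2} g_{θ₂}` on `{‖v‖ ≥ V - 1} ⊇ supp β_{Ve₁}` (`θ₁ ≤ θ₂`):
`G_V ∘ θhot` concentrates at the hot spot `x = 0`; Cauchy–Schwarz on a small closed ball `A ∋ 0`
gives `(∫ F)² ≤ 4 vol(A) ∫ F²` for `V` large, whence `K (∫ F)² < ∫ F²` once `4K vol(A) < 1`.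
-/

noncomputable section

open MeasureTheory Set Filter
open scoped ENNReal InnerProductSpace BigOperators Classical

namespace Summit.AtomisticToContinuum.HydrodynamicLimit.Theorems.EnergyCurrentTailsRungHalf

open Literature.MathematicalPhysics.KineticTheory Literature.Analysis.FluidPDE

/-! ## The bump `β_b(v) = (1 - ‖v - b‖)₊` and the torus temperature `2 - ‖x‖` -/

/-- The bump is nonnegative. -/
theorem bump_nonneg (b v : V3) : 0 ≤ max 0 (1 - ‖v - b‖) := le_max_left _ _

/-- The bump is continuous. -/
theorem continuous_bump (b : V3) : Continuous fun v : V3 => max 0 (1 - ‖v - b‖) :=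
  continuous_const.max (continuous_const.sub (continuous_id.sub continuous_const).norm)

/-- The bump is supported in the closed unit ball around `b`, hence has compact support. -/
theorem hasCompactSupport_bump (b : V3) : HasCompactSupport fun v : V3 => max 0 (1 - ‖v - b‖) := by
  refine HasCompactSupport.intro (isCompact_closedBall b 1) fun v hv => ?_
  rw [Metric.mem_closedBall, dist_eq_norm] at hv
  exact max_eq_left (by linarith)

/-- On `𝕋³ = (ℝ/ℤ)³` (sup norm of the quotient norms), `‖x‖ ≤ 1/2`; hence `2 - ‖x‖ ∈ [3/2, 2]`. -/
theorem hot_bounds (x : T3) : 3 / 2 ≤ 2 - ‖x‖ ∧ 2 - ‖x‖ ≤ 2 := by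
  have : ‖x‖ ≤ 1 / 2 := (pi_norm_le_iff_of_nonneg (by norm_num)).2 fun i => by
    simpa using AddCircle.norm_le_half_period (1 : ℝ) (x := x i)
  exact ⟨by linarith, by linarith [norm_nonneg x]⟩

/-- The Haar probability measure of a closed sup-norm ball of radius `η ≤ 1/2` in `𝕋³` is `(2η)³`. -/
theorem volumeReal_closedBall_T3 {η : ℝ} (h0 : 0 ≤ η) (h : η ≤ 1 / 2) :
    (volume : Measure T3).real (Metric.closedBall (0 : T3) η) = (2 * η) ^ 3 := by
  rw [measureReal_def, volume_pi_closedBall _ h0]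
  simp only [Pi.zero_apply, AddCircle.volume_closedBall, Finset.prod_const, Finset.card_univ,
    Fintype.card_fin]
  rw [min_eq_right (by linarith), ENNReal.toReal_pow, ENNReal.toReal_ofReal (by linarith)]

/-! ## Gaussian facts on `ℝ³` -/

/-- Density form: integration against `gaussMeasure 0 θ` is integration against the centred local
Maxwellian density `(2πθ)^{-3/2} e^{-‖v‖²/(2θ)}` (`θ > 0`). -/
theorem integral_gaussMeasure_eq_density {θ : ℝ} (hθ : 0 < θ) (f : V3 → ℝ) :
    ∫ v, f v ∂gaussMeasure (0 : V3) θ = ∫ v, localMaxwellian 1 θ (0 : V3) v * f v := by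
  rw [← withDensity_localMaxwellian_eq_gaussMeasure hθ 0,
    integral_withDensity_eq_integral_toReal_smul
      (continuous_localMaxwellian 1 θ (0 : V3)).measurable.ennreal_ofReal
      (Eventually.of_forall fun _ => ENNReal.ofReal_lt_top)]
  refine integral_congr_ae (Eventually.of_forall fun v => ?_)
  simp only [smul_eq_mul]
  rw [ENNReal.toReal_ofReal (localMaxwellian_nonneg zero_le_one hθ.le _ _)]

/-- Conjunct (i): `0 < G_b(θ) ≤ 1` for `θ > 0`. -/
theorem gaussBump_pos_le {θ : ℝ} (hθ : 0 < θ) (b : V3) :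
    0 < ∫ v, max 0 (1 - ‖v - b‖) ∂gaussMeasure (0 : V3) θ ∧
      ∫ v, max 0 (1 - ‖v - b‖) ∂gaussMeasure (0 : V3) θ ≤ 1 := by
  constructor
  · rw [integral_gaussMeasure_eq_density hθ]
    refine Continuous.integral_pos_of_hasCompactSupport_nonneg_nonzero (x := b)
      ((continuous_localMaxwellian 1 θ (0 : V3)).mul (continuous_bump b))
      ((hasCompactSupport_bump b).mul_left)
      (fun v => mul_nonneg (localMaxwellian_nonneg zero_le_one hθ.le _ _) (bump_nonneg b v)) ?_
    have : max 0 (1 - ‖b - b‖) = 1 := by simp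
    rw [this, mul_one]
    exact (localMaxwellian_pos one_pos hθ _ _).ne'
  · calc ∫ v, max 0 (1 - ‖v - b‖) ∂gaussMeasure (0 : V3) θ
        ≤ ∫ _v, (1 : ℝ) ∂gaussMeasure (0 : V3) θ :=
          integral_mono ((continuous_bump b).integrable_of_hasCompactSupport (hasCompactSupport_bump b))
            (integrable_const _) fun v => max_le zero_le_one (by linarith [norm_nonneg (v - b)])
      _ = 1 := by simp

/-- Conjunct (ii): reflection symmetry `G_{-b}(θ) = G_b(θ)` of the centred Gaussian (`θ > 0`). -/
theorem gaussBump_reflect {θ : ℝ} (hθ : 0 < θ) (b : V3) :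
    ∫ v, max 0 (1 - ‖v + b‖) ∂gaussMeasure (0 : V3) θ =
      ∫ v, max 0 (1 - ‖v - b‖) ∂gaussMeasure (0 : V3) θ := by
  rw [integral_gaussMeasure_eq_density hθ, integral_gaussMeasure_eq_density hθ,
    ← integral_neg_eq_self (fun v => localMaxwellian 1 θ (0 : V3) v * max 0 (1 - ‖v - b‖)) volume]
  refine integral_congr_ae (Eventually.of_forall fun v => ?_)
  simp only [localMaxwellian, sub_zero, norm_neg, ← neg_add', one_mul]

/-- Conjunct (iii): continuity of `x ↦ G_b(2 - ‖x‖)` on `𝕋³` (dominated convergence after the transfer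
`v = √θ w` to the standard Gaussian; `2 - ‖x‖ > 0`). -/
theorem continuous_gaussBump_hot (b : V3) :
    Continuous fun x : T3 => ∫ v, max 0 (1 - ‖v - b‖) ∂gaussMeasure (0 : V3) (2 - ‖x‖) := by
  have key : ∀ x : T3, ∫ v, max 0 (1 - ‖v - b‖) ∂gaussMeasure (0 : V3) (2 - ‖x‖) =
      ∫ w, max 0 (1 - ‖(0 : V3) + Real.sqrt (2 - ‖x‖) • w - b‖) ∂ProbabilityTheory.stdGaussian V3 :=
    fun x => integral_gaussMeasure (0 : V3) (by linarith [(hot_bounds x).1]) (fun v => max 0 (1 - ‖v - b‖))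
  simp_rw [key]
  have hc1 : ∀ x : T3, Continuous fun w : V3 => max 0 (1 - ‖(0 : V3) + Real.sqrt (2 - ‖x‖) • w - b‖) :=
    fun x => by fun_prop
  have hc2 : ∀ w : V3, Continuous fun x : T3 => max 0 (1 - ‖(0 : V3) + Real.sqrt (2 - ‖x‖) • w - b‖) :=
    fun w => by fun_prop
  refine continuous_of_dominated
    (F := fun (x : T3) (w : V3) => max 0 (1 - ‖(0 : V3) + Real.sqrt (2 - ‖x‖) • w - b‖))
    (bound := fun _ => (1 : ℝ)) (fun x => (hc1 x).aestronglyMeasurable)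
    (fun x => Eventually.of_forall fun w => ?_) (integrable_const _) (Eventually.of_forall hc2)
  rw [Real.norm_eq_abs, abs_of_nonneg (le_max_left _ _)]
  exact max_le zero_le_one (by linarith [norm_nonneg ((0 : V3) + Real.sqrt (2 - ‖x‖) • w - b)])

/-- The Gaussian DENSITY RATIO: for `0 < θ₁ ≤ θ₂` and `‖v‖ ≥ R ≥ 0`,
`g_{θ₁}(v) ≤ (θ₂/θ₁)^{3/2} e^{-R²(θ₁⁻¹ - θ₂⁻¹)/2} g_{θ₂}(v)`. -/
theorem localMaxwellian_le_ratio {θ₁ θ₂ R : ℝ} (h1 : 0 < θ₁) (h12 : θ₁ ≤ θ₂) (hR : 0 ≤ R)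
    {v : V3} (hv : R ≤ ‖v‖) :
    localMaxwellian 1 θ₁ (0 : V3) v ≤
      (θ₂ / θ₁) ^ ((3 : ℝ) / 2) * Real.exp (-(R ^ 2 / 2 * (θ₁⁻¹ - θ₂⁻¹))) *
        localMaxwellian 1 θ₂ (0 : V3) v := by
  have h2 : 0 < θ₂ := h1.trans_le h12
  have hd : (Module.finrank ℝ V3 : ℝ) = 3 := by simp
  simp only [localMaxwellian, one_mul, sub_zero, hd]
  have hA : 0 < 2 * Real.pi * θ₁ := by positivity
  have hA2 : 0 < 2 * Real.pi * θ₂ := by positivity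
  have hc : (2 * Real.pi * θ₁) ^ (-(3 : ℝ) / 2) =
      (θ₂ / θ₁) ^ ((3 : ℝ) / 2) * (2 * Real.pi * θ₂) ^ (-(3 : ℝ) / 2) := by
    have hB : (0 : ℝ) < θ₂ / θ₁ := by positivity
    rw [show -(3 : ℝ) / 2 = -((3 : ℝ) / 2) by ring, Real.rpow_neg hA.le, Real.rpow_neg hA2.le,
      show 2 * Real.pi * θ₂ = (θ₂ / θ₁) * (2 * Real.pi * θ₁) by field_simp,
      Real.mul_rpow hB.le hA.le]
    have hpos : 0 < (θ₂ / θ₁) ^ ((3 : ℝ) / 2) := Real.rpow_pos_of_pos hB _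
    have hpos' : 0 < (2 * Real.pi * θ₁) ^ ((3 : ℝ) / 2) := Real.rpow_pos_of_pos hA _
    field_simp
  have he : Real.exp (-‖v‖ ^ 2 / (2 * θ₁)) ≤
      Real.exp (-(R ^ 2 / 2 * (θ₁⁻¹ - θ₂⁻¹))) * Real.exp (-‖v‖ ^ 2 / (2 * θ₂)) := by
    rw [← Real.exp_add]
    apply Real.exp_le_exp.2
    have hδ : 0 ≤ θ₁⁻¹ - θ₂⁻¹ := sub_nonneg.2 (inv_anti₀ h1 h12)
    have hv2 : R ^ 2 ≤ ‖v‖ ^ 2 := pow_le_pow_left₀ hR hv 2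
    have : -‖v‖ ^ 2 / (2 * θ₁) = -(‖v‖ ^ 2 / 2 * (θ₁⁻¹ - θ₂⁻¹)) + -‖v‖ ^ 2 / (2 * θ₂) := by
      field_simp
      ring
    rw [this]
    have : R ^ 2 / 2 * (θ₁⁻¹ - θ₂⁻¹) ≤ ‖v‖ ^ 2 / 2 * (θ₁⁻¹ - θ₂⁻¹) :=
      mul_le_mul_of_nonneg_right (by linarith) hδ
    linarith
  calc (2 * Real.pi * θ₁) ^ (-(3 : ℝ) / 2) * Real.exp (-‖v‖ ^ 2 / (2 * θ₁))
      ≤ (2 * Real.pi * θ₁) ^ (-(3 : ℝ) / 2) *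
          (Real.exp (-(R ^ 2 / 2 * (θ₁⁻¹ - θ₂⁻¹))) * Real.exp (-‖v‖ ^ 2 / (2 * θ₂))) :=
        mul_le_mul_of_nonneg_left he (Real.rpow_nonneg hA.le _)
    _ = _ := by rw [hc]; ring

/-- The ratio inequality for `G_V(θ) = ∫ β_{Ve₁} dN(0, θ)`: for `0 < θ₁ ≤ θ₂` and `V ≥ 1`,
`G_V(θ₁) ≤ (θ₂/θ₁)^{3/2} e^{-(V-1)²(θ₁⁻¹ - θ₂⁻¹)/2} G_V(θ₂)` (on `supp β_{Ve₁}`, `‖v‖ ≥ V - 1`). -/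
theorem gaussBump_ratio {θ₁ θ₂ V : ℝ} (h1 : 0 < θ₁) (h12 : θ₁ ≤ θ₂) (hV : 1 ≤ V) :
    ∫ v, max 0 (1 - ‖v - V • EuclideanSpace.single (0 : Fin 3) (1 : ℝ)‖) ∂gaussMeasure (0 : V3) θ₁ ≤
      (θ₂ / θ₁) ^ ((3 : ℝ) / 2) * Real.exp (-((V - 1) ^ 2 / 2 * (θ₁⁻¹ - θ₂⁻¹))) *
        ∫ v, max 0 (1 - ‖v - V • EuclideanSpace.single (0 : Fin 3) (1 : ℝ)‖)
          ∂gaussMeasure (0 : V3) θ₂ := by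
  have h2 : 0 < θ₂ := h1.trans_le h12
  set b : V3 := V • EuclideanSpace.single (0 : Fin 3) (1 : ℝ) with hb
  set C : ℝ := (θ₂ / θ₁) ^ ((3 : ℝ) / 2) * Real.exp (-((V - 1) ^ 2 / 2 * (θ₁⁻¹ - θ₂⁻¹)))
  have hbn : ‖b‖ = V := by
    rw [hb, norm_smul, Real.norm_eq_abs, abs_of_nonneg (by linarith)]
    simp
  rw [integral_gaussMeasure_eq_density h1, integral_gaussMeasure_eq_density h2, ← integral_const_mul]
  refine integral_mono_of_nonneg
    (Eventually.of_forall fun v =>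
      mul_nonneg (localMaxwellian_nonneg zero_le_one h1.le _ _) (bump_nonneg b v))
    ((((continuous_localMaxwellian 1 θ₂ (0 : V3)).mul (continuous_bump b)).integrable_of_hasCompactSupport
      (hasCompactSupport_bump b).mul_left).const_mul C)
    (Eventually.of_forall fun v => ?_)
  by_cases hv : max 0 (1 - ‖v - b‖) = 0
  · simp [hv]
  · have hvn : V - 1 ≤ ‖v‖ := by
      have : ‖v - b‖ < 1 := not_le.1 fun h' => hv (max_eq_left (by linarith))
      have := norm_sub_norm_le b v
      rw [← norm_neg (b - v), neg_sub] at this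
      linarith
    calc localMaxwellian 1 θ₁ (0 : V3) v * max 0 (1 - ‖v - b‖)
        ≤ (C * localMaxwellian 1 θ₂ (0 : V3) v) * max 0 (1 - ‖v - b‖) :=
          mul_le_mul_of_nonneg_right (localMaxwellian_le_ratio h1 h12 (by linarith) hvn)
            (bump_nonneg b v)
      _ = C * (localMaxwellian 1 θ₂ (0 : V3) v * max 0 (1 - ‖v - b‖)) := by ring

/-- The prefactor bound `(θ₂/θ₁)^{3/2} ≤ 2` for `3/2 ≤ θ₁ ≤ θ₂ ≤ 2`. -/
theorem rpow_ratio_le_two {θ₁ θ₂ : ℝ} (h1 : 3 / 2 ≤ θ₁) (h12 : θ₁ ≤ θ₂) (h2 : θ₂ ≤ 2) :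
    (θ₂ / θ₁) ^ ((3 : ℝ) / 2) ≤ 2 := by
  have hq : θ₂ / θ₁ ≤ 4 / 3 := by
    rw [div_le_iff₀ (by linarith)]
    linarith
  have hq1 : 1 ≤ θ₂ / θ₁ := by
    rw [le_div_iff₀ (by linarith)]
    linarith
  calc (θ₂ / θ₁) ^ ((3 : ℝ) / 2) ≤ (θ₂ / θ₁) ^ ((2 : ℕ) : ℝ) :=
        Real.rpow_le_rpow_of_exponent_le hq1 (by norm_num)
    _ = (θ₂ / θ₁) ^ 2 := Real.rpow_natCast _ 2
    _ ≤ (4 / 3) ^ 2 := pow_le_pow_left₀ (by linarith) hq 2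
    _ ≤ 2 := by norm_num

/-! ## The concentration mechanism -/

/-- **Core inequality.**  Let `g > 0` on `(0, ∞)` with `x ↦ g(2 - ‖x‖)` continuous on `𝕋³` and the ratio
bound `g θ₁ ≤ 2 e^{-t(θ₁⁻¹ - θ₂⁻¹)} g θ₂` for `3/2 ≤ θ₁ ≤ θ₂ ≤ 2` (`t ≥ 0`).  If `0 < η ≤ 1/2`,
`8 e^{-t((2-η)⁻¹ - (2-η/2)⁻¹)} ≤ η³` and `32 K η³ < 1`, then `K (∫ g(2-‖x‖))² < ∫ g(2-‖x‖)²`: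
split `𝕋³` into `A = B̄(0, η)` and `Aᶜ`; on `Aᶜ` the integrand is exponentially small compared with its
values on `B̄(0, η/2)`, so `∫ F ≤ 2 ∫_A F`, and Cauchy–Schwarz on `A` gives `(∫_A F)² ≤ (2η)³ ∫ F²`. -/
theorem core_concentration {g : ℝ → ℝ} {t η K : ℝ} (hg : ∀ θ, 0 < θ → 0 < g θ)
    (hcont : Continuous fun x : T3 => g (2 - ‖x‖)) (ht : 0 ≤ t)
    (hR : ∀ θ₁ θ₂, 3 / 2 ≤ θ₁ → θ₁ ≤ θ₂ → θ₂ ≤ 2 →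
      g θ₁ ≤ 2 * Real.exp (-(t * (θ₁⁻¹ - θ₂⁻¹))) * g θ₂)
    (hη : 0 < η) (hη2 : η ≤ 1 / 2)
    (hsmall : 8 * Real.exp (-(t * ((2 - η)⁻¹ - (2 - η / 2)⁻¹))) ≤ η ^ 3)
    (hK : 32 * K * η ^ 3 < 1) :
    K * (∫ x : T3, g (2 - ‖x‖)) ^ 2 < ∫ x : T3, (g (2 - ‖x‖)) ^ 2 := by
  set F : T3 → ℝ := fun x => g (2 - ‖x‖) with hF
  have hFpos : ∀ x, 0 < F x := fun x => hg _ (by linarith [(hot_bounds x).1])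
  have hFint : Integrable F := integrable_of_continuous_T3 hcont
  have hF2int : Integrable (fun x => F x ^ 2) := integrable_of_continuous_T3 (hcont.pow 2)
  set ε : ℝ := Real.exp (-(t * ((2 - η)⁻¹ - (2 - η / 2)⁻¹))) with hε
  set A : Set T3 := Metric.closedBall (0 : T3) η with hA_def
  set A' : Set T3 := Metric.closedBall (0 : T3) (η / 2) with hA'_def
  have hA : MeasurableSet A := Metric.isClosed_closedBall.measurableSet
  have hA' : MeasurableSet A' := Metric.isClosed_closedBall.measurableSet
  have hvolA : (volume : Measure T3).real A = (2 * η) ^ 3 := volumeReal_closedBall_T3 hη.le hη2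
  have hvolA' : (volume : Measure T3).real A' = η ^ 3 := by
    rw [hA'_def, volumeReal_closedBall_T3 (by linarith) (by linarith)]
    ring
  -- monotonicity up to the factor 2 (drop the exponential)
  have hmono : ∀ θ θ', 3 / 2 ≤ θ → θ ≤ θ' → θ' ≤ 2 → g θ ≤ 2 * g θ' := by
    intro θ θ' h₁ h₂ h₃
    have hθθ : θ'⁻¹ ≤ θ⁻¹ := inv_anti₀ (by linarith) h₂
    have hexp : Real.exp (-(t * (θ⁻¹ - θ'⁻¹))) ≤ 1 := Real.exp_le_one_iff.2 (by nlinarith)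
    have hg' : 0 < g θ' := hg θ' (by linarith)
    calc g θ ≤ 2 * Real.exp (-(t * (θ⁻¹ - θ'⁻¹))) * g θ' := hR θ θ' h₁ h₂ h₃
      _ ≤ 2 * 1 * g θ' := by gcongr
      _ = 2 * g θ' := by ring
  have hg2pos : 0 < g (2 - η / 2) := hg _ (by linarith)
  -- on `Aᶜ` the integrand is exponentially small, on `A'` it is bounded below
  have hcompl : ∀ x ∈ Aᶜ, F x ≤ 4 * ε * g (2 - η / 2) := by
    intro x hx
    have hxη : η < ‖x‖ := by simpa [hA_def, Metric.mem_closedBall, dist_zero_right] using hx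
    have h₁ : F x ≤ 2 * g (2 - η) := hmono _ _ (hot_bounds x).1 (by linarith) (by linarith)
    have h₂ : g (2 - η) ≤ 2 * ε * g (2 - η / 2) :=
      hR (2 - η) (2 - η / 2) (by linarith) (by linarith) (by linarith)
    linarith
  have hinner : ∀ x ∈ A', g (2 - η / 2) / 2 ≤ F x := by
    intro x hx
    have hxη : ‖x‖ ≤ η / 2 := by simpa [hA'_def, Metric.mem_closedBall, dist_zero_right] using hx
    have := hmono (2 - η / 2) (2 - ‖x‖) (by linarith) (by linarith) (hot_bounds x).2
    change g (2 - η / 2) / 2 ≤ g (2 - ‖x‖)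
    linarith
  -- the integral over `Aᶜ` is dominated by the integral over `A' ⊆ A`
  have hIcompl : ∫ x in Aᶜ, F x ≤ 4 * ε * g (2 - η / 2) := by
    have hc : 0 ≤ 4 * ε * g (2 - η / 2) := by positivity
    calc ∫ x in Aᶜ, F x ≤ ∫ _x in Aᶜ, 4 * ε * g (2 - η / 2) :=
          setIntegral_mono_on hFint.integrableOn (integrableOn_const (measure_ne_top _ _)) hA.compl
            hcompl
      _ = (volume : Measure T3).real Aᶜ * (4 * ε * g (2 - η / 2)) := by
          rw [setIntegral_const, smul_eq_mul]
      _ ≤ 1 * (4 * ε * g (2 - η / 2)) := by gcongr; exact measureReal_le_one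
      _ = 4 * ε * g (2 - η / 2) := one_mul _
  have hIA' : η ^ 3 * (g (2 - η / 2) / 2) ≤ ∫ x in A', F x := by
    have := setIntegral_ge_of_const_le hA' (measure_ne_top _ _) hinner hFint.integrableOn
    rwa [hvolA', smul_eq_mul] at this
  have hA'A : ∫ x in A', F x ≤ ∫ x in A, F x :=
    setIntegral_mono_set hFint.integrableOn (Eventually.of_forall fun x => (hFpos x).le)
      (Eventually.of_forall (Metric.closedBall_subset_closedBall (by linarith)))
  have hρ : ∫ x in Aᶜ, F x ≤ ∫ x in A, F x := by
    calc ∫ x in Aᶜ, F x ≤ 4 * ε * g (2 - η / 2) := hIcompl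
      _ = (8 * ε) * (g (2 - η / 2) / 2) := by ring
      _ ≤ η ^ 3 * (g (2 - η / 2) / 2) := by gcongr
      _ ≤ ∫ x in A, F x := hIA'.trans hA'A
  have hsplit : ∫ x, F x = (∫ x in A, F x) + ∫ x in Aᶜ, F x := (integral_add_compl hA hFint).symm
  have hI1 : ∫ x, F x ≤ 2 * ∫ x in A, F x := by linarith
  have hI1nn : 0 ≤ ∫ x, F x := integral_nonneg fun x => (hFpos x).le
  -- Cauchy–Schwarz on `A` (via `0 ≤ ∫_A (F - c)²`, `c` the mean of `F` on `A`)
  have hCS : (∫ x in A, F x) ^ 2 ≤ (2 * η) ^ 3 * ∫ x in A, F x ^ 2 := by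
    have hb : (0 : ℝ) < (2 * η) ^ 3 := by positivity
    set S : ℝ := ∫ x in A, F x with hS
    set Q : ℝ := ∫ x in A, F x ^ 2 with hQ
    set c : ℝ := S / (2 * η) ^ 3 with hc
    have h0 : 0 ≤ ∫ x in A, (F x - c) ^ 2 := integral_nonneg fun x => sq_nonneg _
    have h1 : ∀ x, (F x - c) ^ 2 = (F x ^ 2 - 2 * c * F x) + c ^ 2 := fun x => by ring
    have hexp : ∫ x in A, (F x - c) ^ 2 = Q - 2 * c * S + c ^ 2 * (2 * η) ^ 3 := by
      have hi1 : Integrable (fun x => F x ^ 2 - 2 * c * F x) ((volume : Measure T3).restrict A) :=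
        hF2int.integrableOn.sub (hFint.integrableOn.const_mul _)
      have hi2 : Integrable (fun _ : T3 => c ^ 2) ((volume : Measure T3).restrict A) :=
        integrable_const _
      simp_rw [h1]
      rw [integral_add hi1 hi2, integral_sub hF2int.integrableOn (hFint.integrableOn.const_mul _),
        integral_const_mul, setIntegral_const, hvolA, smul_eq_mul]
      ring
    have h2 : Q - 2 * c * S + c ^ 2 * (2 * η) ^ 3 = Q - S ^ 2 / (2 * η) ^ 3 := by
      rw [hc]
      field_simp
      ring
    rw [hexp, h2] at h0
    have h3 : S ^ 2 / (2 * η) ^ 3 ≤ Q := by linarith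
    rw [div_le_iff₀ hb] at h3
    linarith
  have hI2A : ∫ x in A, F x ^ 2 ≤ ∫ x, F x ^ 2 :=
    setIntegral_le_integral hF2int (Eventually.of_forall fun x => sq_nonneg _)
  -- `∫ F² > 0`
  have hI2pos : 0 < ∫ x, F x ^ 2 := by
    have h₁ : η ^ 3 * (g (2 - η / 2) / 2) ^ 2 ≤ ∫ x in A', F x ^ 2 := by
      have := setIntegral_ge_of_const_le hA' (measure_ne_top _ _)
        (fun x hx => pow_le_pow_left₀ (by positivity) (hinner x hx) 2) hF2int.integrableOn
      rwa [hvolA', smul_eq_mul] at this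
    have h₂ : ∫ x in A', F x ^ 2 ≤ ∫ x, F x ^ 2 :=
      setIntegral_le_integral hF2int (Eventually.of_forall fun x => sq_nonneg _)
    have h₃ : 0 < η ^ 3 * (g (2 - η / 2) / 2) ^ 2 := by positivity
    linarith
  -- conclusion
  change K * (∫ x, F x) ^ 2 < ∫ x, F x ^ 2
  by_cases hK0 : K ≤ 0
  · exact (mul_nonpos_of_nonpos_of_nonneg hK0 (sq_nonneg _)).trans_lt hI2pos
  · have hK0 : 0 < K := not_le.1 hK0
    have hsq : (∫ x, F x) ^ 2 ≤ (2 * ∫ x in A, F x) ^ 2 := pow_le_pow_left₀ hI1nn hI1 2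
    calc K * (∫ x, F x) ^ 2 ≤ K * (2 * ∫ x in A, F x) ^ 2 := by gcongr
      _ = 4 * K * (∫ x in A, F x) ^ 2 := by ring
      _ ≤ 4 * K * ((2 * η) ^ 3 * ∫ x in A, F x ^ 2) := by gcongr
      _ ≤ 4 * K * ((2 * η) ^ 3 * ∫ x, F x ^ 2) := by gcongr
      _ = (32 * K * η ^ 3) * ∫ x, F x ^ 2 := by ring
      _ < 1 * ∫ x, F x ^ 2 := mul_lt_mul_of_pos_right hK hI2pos
      _ = ∫ x, F x ^ 2 := one_mul _

/-! ## The registered stub -/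

/-- Stub C — HOT-SPOT DIVERGENCE for `G_V(θ) = ∫ (1 - ‖v - Ve₁‖)₊ dN(0, θ)(v)` and
`θhot = 2 - ‖·‖` on `𝕋³`: (i) `0 < G_V ≤ 1`; (ii) reflection symmetry `v ↦ -v`; (iii) continuity of
`G_V ∘ θhot`; (iv) `∫ (G_V ∘ θhot)² / (∫ G_V ∘ θhot)² → ∞` as `V → ∞` (concentration at the hot spot
`x = 0` by the Gaussian density ratio, Cauchy–Schwarz on a small ball). -/
theorem stub_hotSpotDivergence :
    (∀ (V θ : ℝ), 0 < θ →
        0 < ∫ v, max 0 (1 - ‖v - V • EuclideanSpace.single (0 : Fin 3) (1 : ℝ)‖) ∂gaussMeasure (0 : V3) θ ∧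
        ∫ v, max 0 (1 - ‖v - V • EuclideanSpace.single (0 : Fin 3) (1 : ℝ)‖) ∂gaussMeasure (0 : V3) θ ≤ 1) ∧
    (∀ (V θ : ℝ), 0 < θ →
        ∫ v, max 0 (1 - ‖v + V • EuclideanSpace.single (0 : Fin 3) (1 : ℝ)‖) ∂gaussMeasure (0 : V3) θ =
          ∫ v, max 0 (1 - ‖v - V • EuclideanSpace.single (0 : Fin 3) (1 : ℝ)‖) ∂gaussMeasure (0 : V3) θ) ∧
    (∀ V : ℝ, Continuous fun x : T3 =>
        ∫ v, max 0 (1 - ‖v - V • EuclideanSpace.single (0 : Fin 3) (1 : ℝ)‖) ∂gaussMeasure (0 : V3) (2 - ‖x‖)) ∧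
    (∀ K : ℝ, ∃ V₀ : ℝ, ∀ V : ℝ, V₀ ≤ V →
        K * (∫ x : T3, ∫ v, max 0 (1 - ‖v - V • EuclideanSpace.single (0 : Fin 3) (1 : ℝ)‖)
            ∂gaussMeasure (0 : V3) (2 - ‖x‖)) ^ 2 <
          ∫ x : T3, (∫ v, max 0 (1 - ‖v - V • EuclideanSpace.single (0 : Fin 3) (1 : ℝ)‖)
            ∂gaussMeasure (0 : V3) (2 - ‖x‖)) ^ 2) := by
  refine ⟨fun V θ hθ => gaussBump_pos_le hθ _, fun V θ hθ => gaussBump_reflect hθ _,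
    fun V => continuous_gaussBump_hot _, fun K => ?_⟩
  -- the radius `η` of the hot ball: `32 K η³ < 1`
  set η : ℝ := 1 / (64 * (|K| + 1)) with hη
  have hK1 : 0 < |K| + 1 := by positivity
  have hη0 : 0 < η := by positivity
  have hη1 : η ≤ 1 / 2 := by
    rw [hη, div_le_div_iff₀ (by positivity) (by norm_num)]
    nlinarith [abs_nonneg K]
  have hK : 32 * K * η ^ 3 < 1 := by
    have h₁ : 32 * K * η ^ 3 ≤ 32 * |K| * η :=
      calc 32 * K * η ^ 3 ≤ 32 * |K| * η ^ 3 := by gcongr; exact le_abs_self K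
        _ ≤ 32 * |K| * η := by gcongr; exact pow_le_of_le_one hη0.le (by linarith) three_ne_zero
    have h₂ : 32 * |K| * η < 1 := by
      rw [hη, ← mul_div_assoc, mul_one, div_lt_one (by positivity)]
      linarith [abs_nonneg K]
    linarith
  -- the temperature gap `δ` between `Aᶜ` and the half ball; `V₀` with `8 e^{-(V-1)² δ/2} ≤ η³`
  set δ : ℝ := (2 - η)⁻¹ - (2 - η / 2)⁻¹ with hδ
  have hδ0 : 0 < δ := sub_pos.2 (inv_strictAnti₀ (by linarith) (by linarith))
  refine ⟨2 + 16 / (δ * η ^ 3), fun V hV => ?_⟩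
  have hpos16 : 0 < 16 / (δ * η ^ 3) := by positivity
  have hV1 : 1 ≤ V := by linarith
  set t : ℝ := (V - 1) ^ 2 / 2 with ht
  have hsmall : 8 * Real.exp (-(t * δ)) ≤ η ^ 3 := by
    have h8 : 8 ≤ t * δ * η ^ 3 := by
      have hM : 16 / (δ * η ^ 3) * (δ * η ^ 3) = 16 := div_mul_cancel₀ _ (by positivity)
      have h₂ : 16 / (δ * η ^ 3) ≤ 2 * t := by rw [ht]; nlinarith
      nlinarith [mul_pos hδ0 (pow_pos hη0 3)]
    have hexp : Real.exp (-(t * δ)) ≤ 1 / (t * δ + 1) := by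
      rw [Real.exp_neg, ← one_div]
      exact one_div_le_one_div_of_le (by positivity) (Real.add_one_le_exp _)
    calc 8 * Real.exp (-(t * δ)) ≤ 8 * (1 / (t * δ + 1)) := by gcongr
      _ ≤ η ^ 3 := by rw [mul_one_div, div_le_iff₀ (by positivity)]; nlinarith [pow_pos hη0 3]
  exact core_concentration
    (g := fun θ => ∫ v, max 0 (1 - ‖v - V • EuclideanSpace.single (0 : Fin 3) (1 : ℝ)‖)
      ∂gaussMeasure (0 : V3) θ)
    (fun θ hθ => (gaussBump_pos_le hθ _).1) (continuous_gaussBump_hot _) (by positivity)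
    (fun θ₁ θ₂ h₁ h₁₂ h₂ => (gaussBump_ratio (by linarith) h₁₂ hV1).trans
      (mul_le_mul_of_nonneg_right
        (mul_le_mul_of_nonneg_right (rpow_ratio_le_two h₁ h₁₂ h₂) (Real.exp_nonneg _))
        (integral_nonneg fun v => bump_nonneg _ v)))
    hη0 hη1 hsmall hK

end Summit.AtomisticToContinuum.HydrodynamicLimit.Theorems.EnergyCurrentTailsRungHalf
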